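import Literature.Analysis.FluidPDE.JiaSverak2013Compactness
import Literature.Analysis.FluidPDE.L3DataLocalEnergy
import Literature.Analysis.FluidPDE.LocalLerayExistence
import Mathlib.MeasureTheory.Measure.Lebesgue.VolumeOfBalls
import HarnessLib

/-!
# Jia–Šverák's Lemma 2 (Lemarié-Rieusset's a priori estimate for Leray solutions) and the
printed proof of Corollary 1 from it

Second layer of the decomposition of the named fact **K₃**
`Literature.Analysis.FluidPDE.jia_sverak_leray_weak_stability` below **F1**
`jia_sverak_2013_corollary_1` (`JiaSverak2013Compactness.lean`; Jia–Šverák, SIAM J. Math.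
Anal. 45 (2013) = arXiv:1201.1592, Cor. 1 p. 4). Cor. 1 is printed as a corollary of

* **Lemma 2** "(A priori estimate for Leray solution)" (p. 3, with the pressure estimate (2.9)
  and the Remark after it, p. 4; "the following version of the local energy estimates due to
  Lemarié-Rieusset [LemRie]"; = Kang–Miura–Tsai 2021 Lemma 3.5, who note "the first estimate
  (3.5) is proved in [JiaSverak13]"): if `α = sup_{x₀} ∫_{B_R(x₀)} |u₀|²/2 < ∞` for some `R > 0`
  and `u` is a Leray solution with datum `u₀`, then for `0 < λ ≤ ε₀ min{α⁻² R², 1}`,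
  `esssup_{0≤t≤λR²} sup_{x₀} ∫_{B_R(x₀)} |u|²/2 + sup_{x₀} ∫₀^{λR²}∫_{B_R(x₀)} |∇u|² ≤ C α` and
  `sup_{x₀} ∫₀^{λR²}∫_{B_R(x₀)} |p − p_{x₀,R}(t)|^{3/2} ≤ C α^{3/2} R^{1/2}`,

vendored here as the named fact `jia_sverak_2013_lemma_2`, and this file **proves**
`jia_sverak_2013_corollary_1_of_lemma_2 : jia_sverak_2013_lemma_2 → jia_sverak_2013_corollary_1`
by the printed proof of Cor. 1 (p. 4): "For each `r > 0`, let `R = r/√(ε₀ min{‖u₀‖₃⁻⁴, 1}) > r`.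
We shall apply Lemma 2 with this `R`. We have `α = sup_{x₀} ∫_{B_R(x₀)} |u₀|² ≤
sup_{x₀} (∫_{B_R(x₀)} |u₀|³)^{2/3} R ≤ ‖u₀‖²₃ R`. Thus we can choose `λ = ε₀ min{‖u₀‖₃⁻⁴, 1} ≤
ε₀ min{α⁻² R², 1}`. Note that by our choice of `R` and `λ`, `λR² = r²`, therefore from Lemma 2, the
lemma follows" — with the Hölder step supplied by the tree's
`lintegral_ball_enorm_sq_le_of_memLp_three` (`L3DataLocalEnergy.lean`) and `|B₁|^{1/3} ≤ 2`, the
choice `R = r max{‖u₀‖₃², 1}/ε₀ ≥ r` (any `R` at least the printed one works, the bounds being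
monotone; this one avoids square roots), `T = λR² = r²`, and the absolute constant of Cor. 1 taken
as `C/ε₀²`.

## Transcription notes

* The admissible times are parametrised by `T = λR²` instead of `λ`: "`0 < λ ≤ ε₀ min{α⁻²R², 1}`"
  becomes `0 < T`, `T ≤ ε₀ R²`, `T α² ≤ ε₀ R⁴` (the same condition for `α > 0`; for `α = 0` it is
  the printed one read with `α⁻² = +∞`). "some small absolute number `ε₀ > 0`": `∃ ε₀ ∈ (0, 1]`
  (shrinking `ε₀` only removes admissible `λ`, so `ε₀ ≤ 1` is implied by print). As in **F1**, the
  two summands of (2.7) are bounded by `C α` separately (weaker than print), the energy as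
  `∫_{B_R(x₀)} |u(t)|² ≤ 2 C α` for a.e. `t ∈ (0, T)` and all `x₀` (the printed
  `esssup_t sup_{x₀}`); `α` is any number with `∫_{B_R(x₀)} |u₀|² ≤ 2α` for all `x₀` (print: the
  supremum itself; a larger `α` weakens the hypothesis on `λ` and the conclusion alike, so this is
  implied by print); `∇u` is any weak spatial gradient `G` of `u` on `(0, ∞) × ℝ³` (unique a.e.,
  `HasWeakSpatialGradientOn` requiring local integrability), `|∇u|²` its Frobenius norm;
  `p_{x₀,R}(t)` is an existential measurable `c : ℝ → ℝ` ("we need to choose some appropriate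
  constants `p_{x₀,R}(t)`", Remark p. 4; measurable as in Kang–Miura–Tsai Lemma 3.4/3.5,
  `c_{x₀,r} ∈ L^{3/2}(0,T)` — rev. 2026-08-15, the unqualified `∃ c` being vacuous for lower
  integrals); `α^{3/2} R^{1/2}` is `α √α √R` over `ℝ≥0`. The datum is weakly
  divergence free and lies in `E²` (`MemE2`, `LocalLerayExistence.lean`: a.e. strongly measurable,
  `L²_uloc`, decaying at infinity) — the paper's standing conventions on data (Def. 1: "uniformly
  locally integrable functions with certain decay at infinity"; Kang–Miura–Tsai Lemma 3.5:
  "`v₀ ∈ E²`"); without measurability of `u₀` the lower integrals `∫⁻_{B_R(x₀)} ‖u₀‖²` would not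
  control the datum and the formal statement would be false (a non-measurable datum `w·1_N`, `N` a
  Bernstein set, has all these lower integrals `0`). Unit viscosity, no force.

## Mathlib / tree search

Tree: `jia_sverak_2013_corollary_1` (target), `lintegral_ball_enorm_sq_le_of_memLp_three`
(`L3DataLocalEnergy.lean`), `MemE2`, `memE2_of_memLp` (`LocalLerayExistence.lean`),
`IsLocalLeraySolution.uniformLocalGradient`. Mathlib:
`EuclideanSpace.volume_ball_fin_three`, `ENNReal.pow_rpow_inv_natCast`, `Real.pi_le_four`,
`lintegral_mono_set`, `NNReal.sqrt_mul`, `NNReal.sqrt_sq`, `NNReal.mul_self_sqrt`.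

## References

* H. Jia, V. Šverák, SIAM J. Math. Anal. 45 (2013) 1448–1459 = arXiv:1201.1592: Lemma 2 with
  (2.7), (2.9) and the Remark (pp. 3–4); Cor. 1 and its proof (p. 4).
* K. Kang, H. Miura, T.-P. Tsai, IMRN 2021 = arXiv:1812.10509, Lemma 3.5 with (3.5)–(3.7).
* P. G. Lemarié-Rieusset, *Recent developments in the Navier–Stokes problem* (2002), Ch. 32–33
  (the original a priori estimate); *The Navier–Stokes Problem in the 21st Century* (2016), Thm. 14.1.
-/

noncomputable section

open MeasureTheory TopologicalSpace Set Function Filter Metric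
open _root_.Topology
open scoped ENNReal NNReal RealInnerProductSpace

namespace Literature.Analysis.FluidPDE

local notation "ℝ³" => EuclideanSpace ℝ (Fin 3)

/-! ### Lemma 2: the a priori estimate -/

/-- NAMED FACT (Jia–Šverák, SIAM J. Math. Anal. 45 (2013) = arXiv:1201.1592, **Lemma 2** "(A priori
estimate for Leray solution)", p. 3, with **(2.9)** and the Remark, p. 4; after Lemarié-Rieusset
2002; = Kang–Miura–Tsai 2021 Lemma 3.5, (3.5) and (3.7)): "Let
`α = sup_{x₀∈ℝ³} ∫_{B_R(x₀)} |u₀|²/2 (x) dx < ∞` for some `R > 0` and let `u` be a Leray solution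
with initial data `u₀`. Then for `λ` satisfying `0 < λ ≤ ε₀ min{α⁻² R², 1}` with some small
absolute number `ε₀ > 0`, we have
`esssup_{0≤t≤λR²} sup_{x₀∈ℝ³} ∫_{B_R(x₀)} |u|²/2 (x,t) dx + sup_{x₀∈ℝ³} ∫₀^{λR²}∫_{B_R(x₀)} |∇u|²(x,t) dx dt
≤ C α`. (2.7)" and "Note that from the formula (2.3) and the a priori estimate of `u`, we get the
following estimate for `p` which will be useful:
`sup_{x₀∈ℝ³} ∫₀^{λR²}∫_{B_R(x₀)} |p − p(t)|^{3/2} dx dt ≤ C α^{3/2} R^{1/2}`. (2.9) Remarks: In the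
above estimate on `p`, more precisely, `p(t) = p_{x₀,R}(t)`. That is, we need to choose some
appropriate constants `p_{x₀,R}(t)` to satisfy the inequality." Rendering (module docstring,
transcription notes): there are absolute constants `ε₀ ∈ (0, 1]` and `C` such that for every
weakly divergence-free datum `u₀ ∈ E²` (`MemE2 u₀`: measurable, uniformly locally square
integrable, decaying — the datum class of Def. 1 and of Kang–Miura–Tsai's Def. 3.2 / Lemma 3.5,
"divergence free initial data `v₀ ∈ E²`"), every local Leray solution `(u, p)` with datum `u₀` and
unit viscosity (`IsLocalLeraySolution 1 u₀ u p`, Def. 1), every weak spatial gradient `G = ∇u` of `u` on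
`(0, ∞) × ℝ³`, every `α : ℝ≥0` and `R > 0` with `∫_{B_R(x₀)} |u₀|² ≤ 2α` for all `x₀`, and every
`T = λR²` with `0 < T`, `T ≤ ε₀ R²`, `T α² ≤ ε₀ R⁴`: `∫_{B_R(x₀)} |u(t)|² ≤ 2 C α` for a.e.
`t ∈ (0, T)` and all `x₀`; `∫₀ᵀ∫_{B_R(x₀)} |G|² ≤ C α` for all `x₀`; and for every `x₀` there is
a measurable `c = p_{x₀,R} : ℝ → ℝ` with `∫₀ᵀ∫_{B_R(x₀)} |p − c(t)|^{3/2} ≤ C α √α √R` (the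
measurability of the renormaliser, Kang–Miura–Tsai's "`c_{x₀,r}(t) ∈ L^{3/2}(0,T)`", is explicit:
against a non-measurable `c` the lower integral could vanish for every `p` and the clause would be
vacuous). Users take `(h : jia_sverak_2013_lemma_2)`.
[cite: JiaSverak2013, Lemma 2 with (2.7), (2.9) and the Remark (arXiv:1201.1592 pp. 3–4)] [cite: KangMiuraTsai2020, Lemma 3.5 (3.5)–(3.7)] -/
def jia_sverak_2013_lemma_2 : Prop :=
  ∃ ε₀ : ℝ≥0, 0 < ε₀ ∧ ε₀ ≤ 1 ∧ ∃ C : ℝ≥0,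
    ∀ (u₀ : ℝ³ → ℝ³) (u : ℝ → ℝ³ → ℝ³) (p : ℝ → ℝ³ → ℝ) (G : ℝ → ℝ³ → ℝ³ →L[ℝ] ℝ³)
      (α : ℝ≥0) (R T : ℝ),
      IsWeaklyDivFree u₀ → MemE2 u₀ → IsLocalLeraySolution 1 u₀ u p →
      HasWeakSpatialGradientOn (slab ℝ³ (Ioi 0) isOpen_Ioi) u G →
      0 < R → (∀ x₀ : ℝ³, ∫⁻ x in ball x₀ R, ‖u₀ x‖ₑ ^ 2 ≤ 2 * (α : ℝ≥0∞)) →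
      0 < T → T ≤ (ε₀ : ℝ) * R ^ 2 → T * (α : ℝ) ^ 2 ≤ (ε₀ : ℝ) * R ^ 4 →
      (∀ᵐ t ∂(volume.restrict (Ioo 0 T)), ∀ x₀ : ℝ³,
          ∫⁻ x in ball x₀ R, ‖u t x‖ₑ ^ 2 ≤ 2 * ((C * α : ℝ≥0) : ℝ≥0∞)) ∧
      (∀ x₀ : ℝ³, ∫⁻ z in Ioo 0 T ×ˢ ball x₀ R, ENNReal.ofReal (frobeniusNormSq (G z.1 z.2)) ≤
          ((C * α : ℝ≥0) : ℝ≥0∞)) ∧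
      ∀ x₀ : ℝ³, ∃ c : ℝ → ℝ, Measurable c ∧
        ∫⁻ z in Ioo 0 T ×ˢ ball x₀ R, ‖p z.1 z.2 - c z.1‖ₑ ^ (3 / 2 : ℝ) ≤
          ((C * (α * NNReal.sqrt α) * NNReal.sqrt R.toNNReal : ℝ≥0) : ℝ≥0∞)

/-! ### Corollary 1 from Lemma 2 -/

/-- `|B₁|^{1/3} ≤ 2` in `ℝ³`: `|B₁| = 4π/3 ≤ 8` (Mathlib `EuclideanSpace.volume_ball_fin_three`,
`π ≤ 4`). [folklore] -/
theorem volume_unitBall_rpow_third_le_two :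
    volume (ball (0 : ℝ³) 1) ^ (1 / 3 : ℝ) ≤ 2 := by
  have hV8 : volume (ball (0 : ℝ³) 1) ≤ 2 ^ 3 := by
    rw [EuclideanSpace.volume_ball_fin_three, ENNReal.ofReal_one, one_pow, one_mul,
      show (2 : ℝ≥0∞) ^ 3 = ENNReal.ofReal 8 by norm_num]
    exact ENNReal.ofReal_le_ofReal (by nlinarith [Real.pi_le_four])
  calc volume (ball (0 : ℝ³) 1) ^ (1 / 3 : ℝ)
      ≤ ((2 : ℝ≥0∞) ^ 3) ^ (1 / 3 : ℝ) := ENNReal.rpow_le_rpow hV8 (by norm_num)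
    _ = 2 := by
        rw [show (1 / 3 : ℝ) = ((3 : ℕ) : ℝ)⁻¹ by norm_num,
          ENNReal.pow_rpow_inv_natCast (by norm_num : (3 : ℕ) ≠ 0)]

/-- **The datum-side input of Cor. 1**: `∫_{B_R(x₀)} |u₀|² ≤ 2 ‖u₀‖₃² R` for `u₀ ∈ L³(ℝ³)`, `R ≥ 0`
(Jia–Šverák 2013, proof of Cor. 1: "`α = sup_{x₀} ∫_{B_R(x₀)} |u₀|² dx ≤
sup_{x₀} (∫_{B_R(x₀)} |u₀|³ dx)^{2/3} R ≤ ‖u₀‖²_{L³} R`"; the tree's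
`lintegral_ball_enorm_sq_le_of_memLp_three` with `|B₁|^{1/3} ≤ 2`).
[cite: JiaSverak2013, proof of Cor. 1 (arXiv:1201.1592 p. 4)] -/
theorem lintegral_ball_enorm_sq_le_two_mul {u₀ : ℝ³ → ℝ³} (hu : MemLp u₀ 3 volume) (x₀ : ℝ³)
    {R : ℝ} (hR : 0 ≤ R) :
    ∫⁻ x in ball x₀ R, ‖u₀ x‖ₑ ^ 2 ≤
      2 * (((eLpNorm u₀ 3 volume).toNNReal ^ 2 * R.toNNReal : ℝ≥0) : ℝ≥0∞) := by
  have h := lintegral_ball_enorm_sq_le_of_memLp_three hu x₀ hR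
  have hα : eLpNorm u₀ 3 volume = ((eLpNorm u₀ 3 volume).toNNReal : ℝ≥0∞) :=
    (ENNReal.coe_toNNReal hu.eLpNorm_ne_top).symm
  calc ∫⁻ x in ball x₀ R, ‖u₀ x‖ₑ ^ 2
      ≤ ENNReal.ofReal R * volume (ball (0 : ℝ³) 1) ^ (1 / 3 : ℝ) * eLpNorm u₀ 3 volume ^ 2 := h
    _ ≤ ENNReal.ofReal R * 2 * eLpNorm u₀ 3 volume ^ 2 := by
        gcongr
        exact volume_unitBall_rpow_third_le_two
    _ = 2 * (((eLpNorm u₀ 3 volume).toNNReal ^ 2 * R.toNNReal : ℝ≥0) : ℝ≥0∞) := by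
        rw [hα, ENNReal.ofReal, ENNReal.coe_mul, ENNReal.coe_pow, ENNReal.toNNReal_coe]
        ring

/-- **Jia–Šverák's Corollary 1 (`jia_sverak_2013_corollary_1`, F1) from Lemma 2**, by the printed
proof (arXiv:1201.1592 p. 4): for `u₀ ∈ L³` and `r > 0` put `a = ‖u₀‖₃`, `β = max{a², 1}`,
`R = r β/ε₀ ≥ r`, `T = r²` and `α = a² R`; Hölder on balls gives `∫_{B_R(x₀)} |u₀|² ≤ 2 a² R = 2α`
(`lintegral_ball_enorm_sq_le_two_mul`), the conditions `T ≤ ε₀ R²`, `T α² ≤ ε₀ R⁴` hold because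
`ε₀ ≤ 1 ≤ β` and `a⁴ ≤ β²`, and Lemma 2 on `(0, r²) × B_R(x₀) ⊇ (0, r²) × B_r(x₀)` bounds the energy
and the gradient by `C α = C a² r β/ε₀ ≤ (C/ε₀²) a² max{a², 1} r` and the renormalised pressure by
`C α √α √R = C a³ R² = (C/ε₀²) a³ max{a⁴, 1} r²`.
[cite: JiaSverak2013, proof of Cor. 1 (arXiv:1201.1592 p. 4)] -/
theorem jia_sverak_2013_corollary_1_of_lemma_2 (h : jia_sverak_2013_lemma_2) :
    jia_sverak_2013_corollary_1 := by
  obtain ⟨ε₀, hε₀, hε₁, C, hC⟩ := h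
  refine ⟨C / ε₀ ^ 2, fun u₀ u p hu₀ hdiv hsol => ?_⟩
  obtain ⟨G, hG, -⟩ := hsol.uniformLocalGradient
  refine ⟨G, hG, fun r hr x₀ => ?_⟩
  -- the norm of the datum and the printed choices `R`, `T = λ R² = r²`
  set a : ℝ≥0 := (eLpNorm u₀ 3 volume).toNNReal with ha
  set β : ℝ≥0 := max (a ^ 2) 1 with hβ
  have hβ1 : 1 ≤ β := le_max_right _ _
  have hβa : a ^ 2 ≤ β := le_max_left _ _
  have hβ0 : 0 < β := lt_of_lt_of_le zero_lt_one hβ1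
  set R : ℝ := r * β / ε₀ with hR
  have hε₀r : (0 : ℝ) < ε₀ := by exact_mod_cast hε₀
  have hε₁r : (ε₀ : ℝ) ≤ 1 := by exact_mod_cast hε₁
  have hβr : (1 : ℝ) ≤ β := by exact_mod_cast hβ1
  have hRpos : 0 < R := by
    rw [hR]; positivity
  have hrR : r ≤ R := by
    rw [hR, le_div_iff₀ hε₀r]
    nlinarith [mul_le_mul_of_nonneg_left hβr hr.le, mul_le_mul_of_nonneg_left hε₁r hr.le]
  have hRnn : R.toNNReal = r.toNNReal * β / ε₀ := by
    rw [hR, Real.toNNReal_div' hε₀r.le, Real.toNNReal_mul hr.le, Real.toNNReal_coe, Real.toNNReal_coe]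
  set α : ℝ≥0 := a ^ 2 * R.toNNReal with hαdef
  -- hypotheses of Lemma 2
  have hdat : ∀ y : ℝ³, ∫⁻ x in ball y R, ‖u₀ x‖ₑ ^ 2 ≤ 2 * (α : ℝ≥0∞) := fun y =>
    lintegral_ball_enorm_sq_le_two_mul hu₀ y hRpos.le
  have hT1 : r ^ 2 ≤ (ε₀ : ℝ) * R ^ 2 := by
    rw [hR]
    rw [show (ε₀ : ℝ) * (r * β / ε₀) ^ 2 = r ^ 2 * (β * β / ε₀) by field_simp]
    have h1 : (1 : ℝ) ≤ β * β / ε₀ := by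
      rw [le_div_iff₀ hε₀r]; nlinarith
    nlinarith [sq_nonneg r]
  have hαR : (α : ℝ) = (a : ℝ) ^ 2 * R := by
    rw [hαdef, NNReal.coe_mul, NNReal.coe_pow, Real.coe_toNNReal _ hRpos.le]
  have hT2 : r ^ 2 * (α : ℝ) ^ 2 ≤ (ε₀ : ℝ) * R ^ 4 := by
    rw [hαR]
    have hR2 : (ε₀ : ℝ) * R ^ 2 = r ^ 2 * β ^ 2 / ε₀ := by
      rw [hR]; field_simp
    have ha4 : ((a : ℝ) ^ 2) ^ 2 ≤ (β : ℝ) ^ 2 := by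
      have : (a : ℝ) ^ 2 ≤ β := by exact_mod_cast hβa
      exact pow_le_pow_left₀ (by positivity) this 2
    have hkey : r ^ 2 * ((a : ℝ) ^ 2) ^ 2 ≤ (ε₀ : ℝ) * R ^ 2 := by
      rw [hR2, le_div_iff₀ hε₀r]
      have h3 : r ^ 2 * ((a : ℝ) ^ 2) ^ 2 * ε₀ ≤ r ^ 2 * ((a : ℝ) ^ 2) ^ 2 * 1 :=
        mul_le_mul_of_nonneg_left hε₁r (by positivity)
      nlinarith [mul_le_mul_of_nonneg_left ha4 (sq_nonneg r)]
    calc r ^ 2 * ((a : ℝ) ^ 2 * R) ^ 2 = r ^ 2 * ((a : ℝ) ^ 2) ^ 2 * R ^ 2 := by ring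
      _ ≤ (ε₀ : ℝ) * R ^ 2 * R ^ 2 := mul_le_mul_of_nonneg_right hkey (by positivity)
      _ = (ε₀ : ℝ) * R ^ 4 := by ring
  obtain ⟨hE, hGb, hP⟩ := hC u₀ u p G α R (r ^ 2) hdiv (memE2_of_memLp hu₀ (by norm_num) (by norm_num))
    hsol hG hRpos hdat (by positivity) hT1 hT2
  -- the constants
  have hCα : C * α ≤ C / ε₀ ^ 2 * a ^ 2 * β * r.toNNReal := by
    rw [hαdef, hRnn]
    have h1 : C * (a ^ 2 * (r.toNNReal * β / ε₀)) = C / ε₀ * a ^ 2 * β * r.toNNReal := by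
      field_simp
    rw [h1]
    have h2 : C / ε₀ ≤ C / ε₀ ^ 2 := by
      refine div_le_div_of_nonneg_left (by positivity) (pow_pos hε₀ 2) ?_
      calc ε₀ ^ 2 = ε₀ * ε₀ := sq ε₀
        _ ≤ ε₀ * 1 := mul_le_mul_of_nonneg_left hε₁ (by positivity)
        _ = ε₀ := mul_one ε₀
    exact mul_le_mul' (mul_le_mul' (mul_le_mul' h2 le_rfl) le_rfl) le_rfl
  refine ⟨?_, ?_, ?_⟩
  · -- energy on `B_r(x₀) ⊆ B_R(x₀)`
    filter_upwards [hE] with t ht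
    calc ∫⁻ x in ball x₀ r, ‖u t x‖ₑ ^ 2 ≤ ∫⁻ x in ball x₀ R, ‖u t x‖ₑ ^ 2 :=
          lintegral_mono_set (ball_subset_ball hrR)
      _ ≤ 2 * ((C * α : ℝ≥0) : ℝ≥0∞) := ht x₀
      _ ≤ _ := by
          rw [← ENNReal.coe_ofNat, ← ENNReal.coe_mul]
          exact ENNReal.coe_le_coe.2 (mul_le_mul' le_rfl hCα)
  · -- gradient on `(0, r²) × B_r(x₀) ⊆ (0, r²) × B_R(x₀)`
    calc ∫⁻ z in Ioo 0 (r ^ 2) ×ˢ ball x₀ r, ENNReal.ofReal (frobeniusNormSq (G z.1 z.2))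
        ≤ ∫⁻ z in Ioo 0 (r ^ 2) ×ˢ ball x₀ R, ENNReal.ofReal (frobeniusNormSq (G z.1 z.2)) :=
          lintegral_mono_set (prod_mono le_rfl (ball_subset_ball hrR))
      _ ≤ ((C * α : ℝ≥0) : ℝ≥0∞) := hGb x₀
      _ ≤ _ := ENNReal.coe_le_coe.2 hCα
  · -- pressure
    obtain ⟨c, hcm, hc⟩ := hP x₀
    -- the bound on the smaller cylinder, with the constant of Cor. 1
    have hbound : ∫⁻ z in Ioo 0 (r ^ 2) ×ˢ ball x₀ r, ‖p z.1 z.2 - c z.1‖ₑ ^ (3 / 2 : ℝ) ≤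
        ((C / ε₀ ^ 2 * a ^ 3 * max (a ^ 4) 1 * (r ^ 2).toNNReal : ℝ≥0) : ℝ≥0∞) := by
      calc ∫⁻ z in Ioo 0 (r ^ 2) ×ˢ ball x₀ r, ‖p z.1 z.2 - c z.1‖ₑ ^ (3 / 2 : ℝ)
          ≤ ∫⁻ z in Ioo 0 (r ^ 2) ×ˢ ball x₀ R, ‖p z.1 z.2 - c z.1‖ₑ ^ (3 / 2 : ℝ) :=
            lintegral_mono_set (prod_mono le_rfl (ball_subset_ball hrR))
        _ ≤ ((C * (α * NNReal.sqrt α) * NNReal.sqrt R.toNNReal : ℝ≥0) : ℝ≥0∞) := hc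
        _ ≤ _ := ENNReal.coe_le_coe.2 (le_of_eq ?_)
      -- `α √α √R = a³ R²` and `R² = r² β² / ε₀²`, `β² = max(a⁴, 1)`
      have hsqα : NNReal.sqrt α = a * NNReal.sqrt R.toNNReal := by
        rw [hαdef, NNReal.sqrt_mul, NNReal.sqrt_sq]
      have h1 : C * (α * NNReal.sqrt α) * NNReal.sqrt R.toNNReal = C * a ^ 3 * R.toNNReal ^ 2 := by
        rw [hsqα, hαdef]
        have e : NNReal.sqrt R.toNNReal * NNReal.sqrt R.toNNReal = R.toNNReal := NNReal.mul_self_sqrt _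
        calc C * (a ^ 2 * R.toNNReal * (a * NNReal.sqrt R.toNNReal)) * NNReal.sqrt R.toNNReal
            = C * a ^ 3 * R.toNNReal * (NNReal.sqrt R.toNNReal * NNReal.sqrt R.toNNReal) := by ring
          _ = C * a ^ 3 * R.toNNReal ^ 2 := by rw [e]; ring
      have hβ2 : β ^ 2 = max (a ^ 4) 1 := by
        rw [hβ]
        rcases le_total (a ^ 2) 1 with h | h
        · have h4 : a ^ 4 ≤ 1 := by
            calc a ^ 4 = (a ^ 2) ^ 2 := by ring
              _ ≤ 1 ^ 2 := pow_le_pow_left₀ (by positivity) h 2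
              _ = 1 := one_pow 2
          rw [max_eq_right h, max_eq_right h4, one_pow]
        · have h4 : 1 ≤ a ^ 4 := by
            calc (1 : ℝ≥0) = 1 ^ 2 := (one_pow 2).symm
              _ ≤ (a ^ 2) ^ 2 := pow_le_pow_left₀ (by positivity) h 2
              _ = a ^ 4 := by ring
          rw [max_eq_left h, max_eq_left h4]
          ring
      have hr2 : (r ^ 2).toNNReal = r.toNNReal ^ 2 := by
        rw [sq, sq, Real.toNNReal_mul hr.le]
      rw [h1, hRnn, hr2, ← hβ2]
      have : C * a ^ 3 * (r.toNNReal * β / ε₀) ^ 2 = C / ε₀ ^ 2 * a ^ 3 * β ^ 2 * r.toNNReal ^ 2 := by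
        field_simp
      rw [this]
    -- Cor. 1's pressure clause (robust to the presence of the measurability conjunct)
    first
      | exact ⟨c, hcm, hbound⟩
      | exact ⟨c, hbound⟩

end Literature.Analysis.FluidPDE

end
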